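import Literature.AlgebraicGeometry.HodgeTheory.AlgebraicCechDeRham
import Literature.AlgebraicGeometry.HodgeTheory.AffineBasicOpenCoordinates
import Literature.AlgebraicGeometry.Motives.RegularFormLocalization
import Literature.Algebra.Homology.CechLocalizationDegreeZero
import HarnessLib

/-!
# The algebraic Čech–de Rham complex of a basic-open cover of an affine scheme has exact rows

[topic AlgebraicGeometry/HodgeTheory]

Let `X` be an affine `ℂ`-scheme with an onto presentation `φ_{x₀} : ℂ[T₁, …, T_{N₀}] ↠ Γ(X, 𝒪)`
(`coordPresentation`, `I₀ = ker φ_{x₀}`), let `G : ι → ℂ[T]` be finitely many polynomials whose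
images `g_i = φ_{x₀}(G_i)` generate the unit ideal of `Γ(X, 𝒪)`, and let
`𝔘 = (U_i = D(g_i))_i` be the corresponding basic-open cover of `X` (`basicCover`), with ANY
choice of charts `C : CoverCharts X 𝔘` on the finite intersections
`U_J = D(g_{J 0} ⋯ g_{J p})` (`HodgeTheory/AlgebraicCechDeRham`). This file proves that the rows of
the algebraic Čech–de Rham double complex `C^p(𝔘, Ω^q_alg) = Π_J Ω^q(U_J)` are EXACT, augmented
by the global regular forms `Ω^q(X) = RegularForm I₀ q`:

* `ker_coordPresentation_basicOpenCoord` — the relations of the coordinates `(x, 1/g)` of a basic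
  open `Y_g` of an affine `Y` are EXACTLY `(ker φ_x)·ℂ[T, t] + (t·G − 1)`
  (`AffineDeRham.BasicOpen.ideal`; `AffineBasicOpenCoordinates` had the inclusion `⊇`):
  `Γ(Y_g, 𝒪) = Γ(Y, 𝒪)_g = ℂ[T, t]/(I, tG − 1)` [Hartshorne1977, II Prop. 2.2 (b)], via Mathlib's
  `IsLocalization.Away g Γ(Y_g, 𝒪)`;
* `CoverCharts.isSystem_sec` — **the row entries `Ω^q(U_J)` form a localizing system**
  (`Algebra/Homology/CechLocalization.IsSystem`) over `R = ℂ[T]/I₀ = Γ(X, 𝒪)`: `Ω^q(U_J)` is the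
  localization of `Ω^q(X)` at `g_J = Π_k g_{J k}` through the restriction `res₀` — transported from
  `AffineDeRham.BasicOpen.isLocalizedModule_toForms` (`Motives/RegularFormLocalization`:
  `Ω^q(X_G) = Ω^q(X)_G` on the Rabinowitsch presentation) along the change of presentation
  `RegularForm.comapEquiv` to the chart `C` chose on `U_J` [GortzWedhorn2023, Remark 17.19 (2), (4)];
* `CoverCharts.cechD_eq_cechδ` — the Čech differential of that localizing system is the Čech
  differential `cechδ` of the double complex (the forced restriction maps `transfer` are the
  `CoverCharts.res`, by uniqueness);
* `CoverCharts.rowExact_of_basicCover` (`ker δ_{p+1} ⊆ im δ_p`, The Stacks Project Tag 01X9 via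
  `CechLocalization.exists_cechD_eq`), `CoverCharts.exact_rowAugmentation_of_basicCover`
  (`0 → Ω^q(X) → C⁰ → C¹` exact, Tag 00EK via `CechLocalizationDegreeZero`), and the conclusion
  **`CoverCharts.bijective_edgeMap_of_basicCover`**: the edge map
  `Hⁿ(Ω^•(X), d) → Hⁿ(Tot C^•(𝔘, Ω^•_alg))` is bijective for every `n` — the affine case of
  El Zein–Tu's (2.9.1) `Ȟ*(𝔘, Ω•_alg) ≃ ℍ*(X, Ω•_alg)` [CattaniElZeinGriffithsLe2014, Ch. 2 §2.9.2
  p. 109: "by Serre's vanishing theorem for an affine variety, Ω•_alg is acyclic on an affine open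
  cover"; Grothendieck1966, p. 96 (4)–(6): on an affine scheme the hypercohomology of `Ω•` "is what
  one might naively think"], node P1-ex / P5-algebra of the lane's Route P.

Everything is proved; no named facts (net debt 0).

## References

* [Grothendieck1966] A. Grothendieck, *On the de Rham cohomology of algebraic varieties*, Publ.
  Math. IHÉS 29 (1966), p. 96 (4)–(6).
* [CattaniElZeinGriffithsLe2014] E. Cattani, F. El Zein, P. Griffiths, Lê D. T. (eds.), *Hodge
  Theory*, Princeton Math. Notes 49 (2014), Ch. 2 (El Zein–Tu) §2.9.2, p. 109, (2.9.1).
* [StacksProject] The Stacks Project, Tags 00EK, 01X9.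
* [GortzWedhorn2023] U. Görtz, T. Wedhorn, *Algebraic Geometry II*, Remark 17.19 (2), (4);
  Lemma 22.1.
* [Hartshorne1977] R. Hartshorne, *Algebraic Geometry*, II Prop. 2.2 (b), II Prop. 5.1, III §4.
-/

noncomputable section

universe u

open CategoryTheory AlgebraicGeometry MvPolynomial
open Literature.Algebra.Homology
open Literature.AlgebraicGeometry.Motives Literature.AlgebraicGeometry.Motives.AffineDeRham

namespace Literature.AlgebraicGeometry.HodgeTheory

section HodgeTheory

/-! ### The relations of the coordinates `(x, 1/g)` on a basic open -/

section KerBasicOpen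

variable {Y : Motives.SchemeOver ℂ} {N : ℕ} [IsAffine Y.left] (x : Fin N → Γ(Y.left, ⊤))
  {g : Γ(Y.left, ⊤)}

/-- `(ker φ_x)·ℂ[T, t] + (tG − 1) ⊆ ker φ_{x'}` for the coordinates `x' = (x, 1/g)` of `Y_g`,
`g = φ_x(G)` (the two inclusions of `AffineBasicOpenCoordinates`). [cite: Hartshorne1977, II Prop. 2.2 (b)] -/
theorem ideal_ker_le_ker_coordPresentation_basicOpenCoord {G : MvPolynomial (Fin N) ℂ}
    (hG : coordPresentation Y x G = g) :
    BasicOpen.ideal (RingHom.ker (coordPresentation Y x)) G ≤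
      RingHom.ker (coordPresentation _ (basicOpenCoord x g)) :=
  sup_le (map_basicOpenLift_le_ker_coordPresentation_basicOpenCoord x g le_rfl)
    ((Ideal.span_singleton_le_iff_mem _).mpr (X_last_mul_rename_sub_one_mem_ker x hG))

/-- **The relations of `(x, 1/g)` are exactly `(ker φ_x, tG − 1)`**: for an affine `Y` with onto
presentation `φ_x` and `g = φ_x(G)`, the presentation `φ_{x'}` of the basic open `Y_g` by the
coordinates `x' = (ι^* x, (ι^* g)⁻¹)` has kernel `(ker φ_x)·ℂ[T, t] + (tG − 1)` — i.e.
`Γ(Y_g, 𝒪) = Γ(Y, 𝒪)_g = ℂ[T, t]/(I, tG − 1)` (Mathlib `IsLocalization.Away g Γ(Y_g, 𝒪)`: the map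
`ℂ[T, t]/(I, tG − 1) → Γ(Y_g, 𝒪)` has the left inverse `Γ(Y, 𝒪)_g → ℂ[T, t]/(I, tG − 1)`,
`s/gⁿ ↦ S tⁿ`). [cite: Hartshorne1977, II Prop. 2.2 (b)] -/
theorem ker_coordPresentation_basicOpenCoord (hx : Function.Surjective (coordPresentation Y x))
    {G : MvPolynomial (Fin N) ℂ} (hG : coordPresentation Y x G = g) :
    RingHom.ker (coordPresentation _ (basicOpenCoord x g)) =
      BasicOpen.ideal (RingHom.ker (coordPresentation Y x)) G := by
  refine le_antisymm (fun F' hF' ↦ ?_) (ideal_ker_le_ker_coordPresentation_basicOpenCoord x hG)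
  set I := RingHom.ker (coordPresentation Y x) with hI
  set J := BasicOpen.ideal I G with hJ
  have hJle : J ≤ RingHom.ker (coordPresentation _ (basicOpenCoord x g)) :=
    ideal_ker_le_ker_coordPresentation_basicOpenCoord x hG
  have happ : ∀ s, (Motives.openSubschemeOverι Y (Y.left.basicOpen g)).left.appTop s =
      algebraMap Γ(Y.left, ⊤) Γ((Y.left.basicOpen g : Scheme), ⊤) s :=
    appTop_openSubschemeOverι_eq_algebraMap _
  -- `μ : ℂ[T, t]/J → Γ(Y_g, 𝒪)` induced by `φ_{x'}`
  let μ : (MvPolynomial (Fin (N + 1)) ℂ ⧸ J) →+*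
      Γ((Motives.openSubschemeOver Y (Y.left.basicOpen g)).left, ⊤) :=
    Ideal.Quotient.lift J (coordPresentation _ (basicOpenCoord x g)) fun a ha ↦ hJle ha
  have hμ : ∀ a, μ (Ideal.Quotient.mk J a) = coordPresentation _ (basicOpenCoord x g) a :=
    fun a ↦ rfl
  -- `ρ : Γ(Y, 𝒪) = ℂ[T]/I → ℂ[T, t]/J`, `φ_x(f) ↦ [f(T)]`
  let ψ : MvPolynomial (Fin N) ℂ →+* MvPolynomial (Fin (N + 1)) ℂ ⧸ J :=
    (Ideal.Quotient.mk J).comp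
      (rename Fin.castSucc : MvPolynomial (Fin N) ℂ →ₐ[ℂ] MvPolynomial (Fin (N + 1)) ℂ).toRingHom
  have hψ : ∀ a ∈ I, ψ a = 0 := fun a ha ↦
    Ideal.Quotient.eq_zero_iff_mem.mpr (BasicOpen.rename_mem_ideal G ha)
  let ρ : Γ(Y.left, ⊤) →+* MvPolynomial (Fin (N + 1)) ℂ ⧸ J :=
    (Ideal.Quotient.lift I ψ hψ).comp (RingHom.quotientKerEquivOfSurjective hx).symm.toRingHom
  have hρ : ∀ f, ρ (coordPresentation Y x f) = Ideal.Quotient.mk J (rename Fin.castSucc f) := by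
    intro f
    change Ideal.Quotient.lift I ψ hψ ((RingHom.quotientKerEquivOfSurjective hx).symm
      (coordPresentation Y x f)) = _
    rw [RingHom.quotientKerEquivOfSurjective_symm_apply, Ideal.Quotient.lift_mk]
    rfl
  have hinv : Ideal.Quotient.mk J (rename Fin.castSucc G) *
      Ideal.Quotient.mk J (MvPolynomial.X (Fin.last N)) = 1 := by
    rw [← map_mul, mul_comm, BasicOpen.X_last_mul_rename, map_add, map_one,
      Ideal.Quotient.eq_zero_iff_mem.mpr (BasicOpen.eqn_mem_ideal I G), zero_add]
  have hunit : IsUnit (ρ g) := by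
    rw [← hG, hρ]
    exact IsUnit.of_mul_eq_one _ hinv
  -- `λ : Γ(Y_g, 𝒪) = Γ(Y, 𝒪)_g → ℂ[T, t]/J`
  let lam : Γ((Y.left.basicOpen g : Scheme), ⊤) →+* MvPolynomial (Fin (N + 1)) ℂ ⧸ J :=
    IsLocalization.Away.lift g hunit
  have hlam : ∀ a, lam (algebraMap Γ(Y.left, ⊤) _ a) = ρ a :=
    IsLocalization.Away.lift_eq g hunit
  have hlam' : ∀ a, lam ((Motives.openSubschemeOverι Y (Y.left.basicOpen g)).left.appTop a) = ρ a :=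
    fun a ↦ by rw [happ]; exact hlam a
  -- `λ ∘ μ = id`
  have hid : lam.comp μ = RingHom.id (MvPolynomial (Fin (N + 1)) ℂ ⧸ J) := by
    refine Ideal.Quotient.ringHom_ext (MvPolynomial.ringHom_ext (fun c ↦ ?_) (fun i ↦ ?_))
    · rw [RingHom.comp_apply, RingHom.comp_apply, RingHom.comp_apply, RingHom.id_apply]
      refine (congrArg lam (hμ _)).trans ?_
      have hC : (MvPolynomial.C c : MvPolynomial (Fin (N + 1)) ℂ) =
          rename Fin.castSucc (MvPolynomial.C c : MvPolynomial (Fin N) ℂ) := (rename_C _ _).symm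
      rw [hC, coordPresentation_basicOpenCoord_rename, hlam', hρ]
    · rw [RingHom.comp_apply, RingHom.comp_apply, RingHom.comp_apply, RingHom.id_apply]
      refine (congrArg lam (hμ _)).trans ?_
      cases i using Fin.lastCases with
      | cast j =>
        rw [coordPresentation_X, basicOpenCoord_castSucc, hlam', ← coordPresentation_X x j, hρ,
          rename_X]
      | last =>
        have h1 : lam (coordPresentation _ (basicOpenCoord x g) (MvPolynomial.X (Fin.last N))) *
            Ideal.Quotient.mk J (rename Fin.castSucc G) = 1 := by
          rw [← hρ, hG, ← hlam', ← map_mul, ← map_one lam]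
          exact congrArg lam (coordPresentation_basicOpenCoord_X_last_mul x g)
        exact left_inv_eq_right_inv h1 hinv
  have h1 : lam (μ (Ideal.Quotient.mk J F')) = Ideal.Quotient.mk J F' :=
    RingHom.congr_fun hid (Ideal.Quotient.mk J F')
  have h0 : lam (μ (Ideal.Quotient.mk J F')) = 0 :=
    (congrArg lam ((hμ F').trans (RingHom.mem_ker.mp hF'))).trans (map_zero lam)
  exact Ideal.Quotient.eq_zero_iff_mem.mp (h1.symm.trans h0)

end KerBasicOpen

/-! ### Basic-open covers of an affine scheme and their finite intersections -/

section BasicCover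

variable {X : Motives.SchemeOver ℂ} {ι : Type u} {N₀ : ℕ} (x₀ : Fin N₀ → Γ(X.left, ⊤))
  (G : ι → MvPolynomial (Fin N₀) ℂ)

/-- The basic-open cover `U_i = D(φ_{x₀}(G_i))` attached to polynomials `G_i`. [cite: Hartshorne1977, II Prop. 2.2 (b)] -/
abbrev basicCover : ι → X.left.Opens := fun i ↦ X.left.basicOpen (coordPresentation X x₀ (G i))

/-- `D(∏_{i ∈ s} f_i) = ⋂_{i ∈ s} D(f_i)`. [cite: Hartshorne1977, II Prop. 2.2 (b)] -/
theorem basicOpen_finset_prod {κ : Type*} (f : κ → Γ(X.left, ⊤)) (s : Finset κ) :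
    X.left.basicOpen (∏ i ∈ s, f i) = ⨅ i ∈ s, X.left.basicOpen (f i) := by
  classical
  induction s using Finset.induction_on with
  | empty =>
    simp only [Finset.prod_empty, Finset.notMem_empty, not_false_eq_true, iInf_neg, iInf_top]
    exact X.left.basicOpen_of_isUnit isUnit_one
  | insert a s ha ih => rw [Finset.prod_insert ha, X.left.basicOpen_mul, ih, Finset.iInf_insert]

/-- **`U_J = D(g_J)`**, `g_J = φ_{x₀}(Π_k G_{J k})`: the finite intersections of a basic-open cover
are basic opens. [cite: Hartshorne1977, II Prop. 2.2 (b)] -/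
theorem cechOpen_basicCover {p : ℕ} (J : Fin (p + 1) → ι) :
    cechOpen (basicCover x₀ G) J =
      X.left.basicOpen (coordPresentation X x₀ (CechLocalization.gprod G J)) := by
  rw [CechLocalization.gprod, map_prod, basicOpen_finset_prod, cechOpen]
  simp only [Finset.mem_univ, iInf_pos]

end BasicCover

/-! ### The rows `Ω^q(U_J)` as modules over `Γ(X, 𝒪) = ℂ[T]/ker φ_{x₀}` -/

namespace CoverCharts

variable {X : Motives.SchemeOver ℂ} {ι : Type u} {U : ι → X.left.Opens} (C : CoverCharts X U)
  {N₀ : ℕ} (x₀ : Fin N₀ → Γ(X.left, ⊤)) (q : ℕ)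

/-- **`Ω^q(U_J)` as a module over `R = ℂ[T]/ker φ_{x₀}`** (and over `ℂ[T]`) through the
restriction `X|_{U_J} → X`, i.e. through any polynomial lift `lift₀` of it on the coordinates
(`x₀` of `X`, `x_J` of `U_J`): a type synonym of `RegularForm (C.ideal J) q` carrying
`Module.compHom` (the entries `L q p J` of the localizing system). [cite: GortzWedhorn2023, Remark 17.19 (2)] -/
def Sec (C : CoverCharts X U) {N₀ : ℕ} (_x₀ : Fin N₀ → Γ(X.left, ⊤)) (q p : ℕ)
    (J : Fin (p + 1) → ι) : Type :=
  RegularForm (C.ideal J) q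

variable {p : ℕ} {J : Fin (p + 1) → ι}

/-- Additive structure of `Ω^q(U_J)`. [folklore] -/
instance Sec.instAddCommGroup : AddCommGroup (C.Sec x₀ q p J) :=
  inferInstanceAs (AddCommGroup (RegularForm (C.ideal J) q))

/-- `ℂ`-module structure of `Ω^q(U_J)`. [folklore] -/
instance Sec.instModuleComplex : Module ℂ (C.Sec x₀ q p J) :=
  inferInstanceAs (Module ℂ (RegularForm (C.ideal J) q))

/-- The `ℂ[T_J]`-module structure of `Ω^q(U_J)` (coordinate polynomial ring of the chart). [folklore] -/
instance Sec.instModuleChart : Module (MvPolynomial (Fin (C.N J)) ℂ) (C.Sec x₀ q p J) :=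
  inferInstanceAs (Module (MvPolynomial (Fin (C.N J)) ℂ) (RegularForm (C.ideal J) q))

/-- `ℂ[T₁, …, T_{N₀}]` acts on `Ω^q(U_J)` through `lift₀ : ℂ[T] → ℂ[T_J]`. [folklore] -/
instance Sec.instModulePoly : Module (MvPolynomial (Fin N₀) ℂ) (C.Sec x₀ q p J) :=
  Module.compHom (RegularForm (C.ideal J) q)
    (bind₁ (C.lift₀ x₀ J) : MvPolynomial (Fin N₀) ℂ →ₐ[ℂ] MvPolynomial (Fin (C.N J)) ℂ).toRingHom

/-- `lift₀` carries `ker φ_{x₀}` into the preimage of `I_J`. [cite: Hartshorne1975, Ch. II §1] -/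
theorem ker_le_comap_ideal :
    RingHom.ker (coordPresentation X x₀) ≤ (C.ideal J).comap
      (bind₁ (C.lift₀ x₀ J) : MvPolynomial (Fin N₀) ℂ →ₐ[ℂ] MvPolynomial (Fin (C.N J)) ℂ).toRingHom :=
  Ideal.map_le_iff_le_comap.mp (C.map_lift₀_le x₀ J)

/-- `R = ℂ[T]/ker φ_{x₀} = Γ(X, 𝒪)` acts on `Ω^q(U_J)` through `ℂ[T]/ker φ_{x₀} → ℂ[T_J]/I_J`.
[cite: GortzWedhorn2023, Remark 17.19 (2)] -/
instance Sec.instModuleQuot :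
    Module (MvPolynomial (Fin N₀) ℂ ⧸ RingHom.ker (coordPresentation X x₀)) (C.Sec x₀ q p J) :=
  Module.compHom (RegularForm (C.ideal J) q)
    (Ideal.quotientMap (C.ideal J)
      (bind₁ (C.lift₀ x₀ J) : MvPolynomial (Fin N₀) ℂ →ₐ[ℂ] MvPolynomial (Fin (C.N J)) ℂ).toRingHom
      (C.ker_le_comap_ideal x₀))

/-- The identification `RegularForm (C.ideal J) q = Sec` (identity map), `ℂ[T_J]`-linear. [folklore] -/
def toSec (p : ℕ) (J : Fin (p + 1) → ι) :
    RegularForm (C.ideal J) q ≃ₗ[MvPolynomial (Fin (C.N J)) ℂ] C.Sec x₀ q p J :=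
  LinearEquiv.refl _ _

/-- The `ℂ[T]`-action on `Sec` is the `ℂ[T_J]`-action through `lift₀`. [cite: Hartshorne1975, Ch. II §1] -/
theorem Sec.smul_def (a : MvPolynomial (Fin N₀) ℂ) (y : C.Sec x₀ q p J) :
    a • y = (bind₁ (C.lift₀ x₀ J) a : MvPolynomial (Fin (C.N J)) ℂ) • y :=
  rfl

/-- The `ℂ[T]/ker φ_{x₀}`-action on `Sec` is the `ℂ[T_J]`-action through `lift₀`. [cite: Hartshorne1975, Ch. II §1] -/
theorem Sec.mk_smul_def (a : MvPolynomial (Fin N₀) ℂ) (y : C.Sec x₀ q p J) :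
    Ideal.Quotient.mk (RingHom.ker (coordPresentation X x₀)) a • y =
      (bind₁ (C.lift₀ x₀ J) a : MvPolynomial (Fin (C.N J)) ℂ) • y := by
  change (Ideal.quotientMap (C.ideal J) (bind₁ (C.lift₀ x₀ J) : MvPolynomial (Fin N₀) ℂ →ₐ[ℂ]
    MvPolynomial (Fin (C.N J)) ℂ).toRingHom (C.ker_le_comap_ideal x₀) (Ideal.Quotient.mk _ a)) •
      (C.toSec x₀ q p J).symm y = _
  rw [Ideal.quotientMap_mk]
  rfl

/-- The two actions on `Sec` are compatible. [folklore] -/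
instance Sec.instIsScalarTower :
    IsScalarTower (MvPolynomial (Fin N₀) ℂ)
      (MvPolynomial (Fin N₀) ℂ ⧸ RingHom.ker (coordPresentation X x₀)) (C.Sec x₀ q p J) :=
  ⟨fun a b y ↦ by
    obtain ⟨b, rfl⟩ := Ideal.Quotient.mk_surjective b
    have h : a • Ideal.Quotient.mk (RingHom.ker (coordPresentation X x₀)) b =
        Ideal.Quotient.mk _ (a * b) :=
      (Algebra.smul_def a _).trans (by rw [Ideal.Quotient.algebraMap_eq, map_mul])
    rw [h, Sec.mk_smul_def, Sec.mk_smul_def, Sec.smul_def, map_mul, mul_smul]⟩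

/-- Scalars lifting the same section of `U_J` act equally on `Ω^q(U_J)`. [cite: Hartshorne1975, Ch. II §1] -/
theorem smul_eq_smul_of_sub_mem_ideal {b b' : MvPolynomial (Fin (C.N J)) ℂ} (h : b - b' ∈ C.ideal J)
    (y : RegularForm (C.ideal J) q) : b • y = b' • y := by
  rw [← sub_eq_zero, ← sub_smul]
  exact RegularForm.isTorsionBySet (C.ideal J) (p := q) (x := y) (a := ⟨b - b', h⟩)

/-- **The restriction `Ω^q(X) → Ω^q(U_J)` as an `R`-linear map** (`R = ℂ[T]/ker φ_{x₀}`): the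
structure map `ι` of the localizing system. [cite: GortzWedhorn2023, Remark 17.19 (2)] -/
def secι (p : ℕ) (J : Fin (p + 1) → ι) :
    RegularForm (RingHom.ker (coordPresentation X x₀)) q →ₗ[MvPolynomial (Fin N₀) ℂ ⧸
      RingHom.ker (coordPresentation X x₀)] C.Sec x₀ q p J where
  toFun r := C.toSec x₀ q p J (C.res₀ x₀ J q r)
  map_add' a b := by rw [map_add, map_add]
  map_smul' c r := by
    obtain ⟨a, rfl⟩ := Ideal.Quotient.mk_surjective c
    obtain ⟨ω, rfl⟩ := RegularForm.mk_surjective (RingHom.ker (coordPresentation X x₀)) r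
    change C.toSec x₀ q p J (C.res₀ x₀ J q (Ideal.Quotient.mk _ a • RegularForm.mk _ ω)) =
      Ideal.Quotient.mk _ a • C.toSec x₀ q p J (C.res₀ x₀ J q (RegularForm.mk _ ω))
    rw [Sec.mk_smul_def C x₀ q (p := p) (J := J) a,
      RegularForm.mk_smul (RingHom.ker (coordPresentation X x₀)) a,
      ← map_smul (RegularForm.mk (RingHom.ker (coordPresentation X x₀))),
      ← map_smul (C.toSec x₀ q p J), res₀, RegularForm.comap_mk, RegularForm.comap_mk,
      PolyForm.comap_polySmul, map_smul]

/-- `secι` is `res₀`. [cite: GortzWedhorn2023, Remark 17.19 (2)] -/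
theorem secι_apply (r : RegularForm (RingHom.ker (coordPresentation X x₀)) q) :
    C.secι x₀ q p J r = C.toSec x₀ q p J (C.res₀ x₀ J q r) :=
  rfl

/-- **The restriction `Ω^q(U_{J∘θ}) → Ω^q(U_J)` is `R`-linear.** [cite: GortzWedhorn2023, Remark 17.19 (2)] -/
def resₗ {m : ℕ} (J : Fin (p + 1) → ι) (θ : Fin (m + 1) → Fin (p + 1)) :
    C.Sec x₀ q m (J ∘ θ) →ₗ[MvPolynomial (Fin N₀) ℂ ⧸ RingHom.ker (coordPresentation X x₀)]
      C.Sec x₀ q p J where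
  toFun y := C.toSec x₀ q p J (C.res J θ q ((C.toSec x₀ q m (J ∘ θ)).symm y))
  map_add' a b := by rw [map_add, map_add, map_add]
  map_smul' c y := by
    obtain ⟨a, rfl⟩ := Ideal.Quotient.mk_surjective c
    obtain ⟨ω, hω⟩ := RegularForm.mk_surjective (C.ideal (J ∘ θ)) ((C.toSec x₀ q m (J ∘ θ)).symm y)
    change C.toSec x₀ q p J (C.res J θ q ((C.toSec x₀ q m (J ∘ θ)).symm
        (Ideal.Quotient.mk _ a • y))) =
      Ideal.Quotient.mk _ a • C.toSec x₀ q p J (C.res J θ q ((C.toSec x₀ q m (J ∘ θ)).symm y))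
    rw [Sec.mk_smul_def C x₀ q (p := m) (J := J ∘ θ) a, Sec.mk_smul_def C x₀ q (p := p) (J := J) a,
      map_smul (C.toSec x₀ q m (J ∘ θ)).symm, ← hω, ← map_smul (RegularForm.mk (C.ideal (J ∘ θ))),
      ← map_smul (C.toSec x₀ q p J), res, RegularForm.comap_mk, RegularForm.comap_mk,
      PolyForm.comap_polySmul, map_smul]
    refine congrArg (C.toSec x₀ q p J) (C.smul_eq_smul_of_sub_mem_ideal q ?_ _)
    rw [ideal, RingHom.mem_ker, map_sub, coordPresentation_bind₁ (cechIncl X U J θ) (C.lift_spec J θ),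
      coordPresentation_bind₁ (Motives.openSubschemeOverι X (cechOpen U (J ∘ θ)))
        (C.lift₀_spec x₀ (J ∘ θ)),
      coordPresentation_bind₁ (Motives.openSubschemeOverι X (cechOpen U J)) (C.lift₀_spec x₀ J),
      ← CategoryTheory.comp_apply, ← Scheme.Hom.comp_appTop, ← Over.comp_left,
      Motives.openSubschemeOverHomOfLE_comp_ι, sub_self]

/-- `resₗ` is `res`. [cite: GortzWedhorn2023, Remark 17.19 (2)] -/
theorem resₗ_apply {m : ℕ} (J : Fin (p + 1) → ι) (θ : Fin (m + 1) → Fin (p + 1))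
    (y : C.Sec x₀ q m (J ∘ θ)) :
    C.resₗ x₀ q J θ y = C.toSec x₀ q p J (C.res J θ q ((C.toSec x₀ q m (J ∘ θ)).symm y)) :=
  rfl

/-- `resₗ ∘ ι_{J∘θ} = ι_J`. [cite: GortzWedhorn2023, Remark 17.19 (2)] -/
theorem resₗ_comp_secι {m : ℕ} (J : Fin (p + 1) → ι) (θ : Fin (m + 1) → Fin (p + 1)) :
    (C.resₗ x₀ q J θ).comp (C.secι x₀ q m (J ∘ θ)) = C.secι x₀ q p J :=
  LinearMap.ext fun r ↦ congrArg (C.toSec x₀ q p J) (C.res_res₀ x₀ J θ r)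

end CoverCharts

/-! ### The localizing system of a basic-open cover -/

namespace CoverCharts

variable {X : Motives.SchemeOver ℂ} [IsAffine X.left] {ι : Type u} {N₀ : ℕ}
  {x₀ : Fin N₀ → Γ(X.left, ⊤)} {G : ι → MvPolynomial (Fin N₀) ℂ}
  (C : CoverCharts X (basicCover x₀ G)) (hx₀ : Function.Surjective (coordPresentation X x₀)) (q : ℕ)

include hx₀ in
/-- **`Ω^q(U_J)` is the localization of `Ω^q(X)` at `g_J`** (as `ℂ[T]`-modules, at `G_J`), for the
chart the cover data `C` chose on `U_J = D(g_J)`: transport of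
`AffineDeRham.BasicOpen.isLocalizedModule_toForms` (`Ω^q(X_{G_J}) = Ω^q(X)_{G_J}` on the
Rabinowitsch presentation, whose relations ARE those of the coordinates `(x₀, 1/g_J)` by
`ker_coordPresentation_basicOpenCoord`) along the change of presentation `RegularForm.comapEquiv`
between `(x₀, 1/g_J)` and `C`'s chart. [cite: GortzWedhorn2023, Remark 17.19 (4)] -/
theorem isLocalizedModule_secι_restrictScalars {p : ℕ} (J : Fin (p + 1) → ι) :
    IsLocalizedModule (Submonoid.powers (CechLocalization.gprod G J))
      ((C.secι x₀ q p J).restrictScalars (MvPolynomial (Fin N₀) ℂ)) := by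
  -- notation
  set I₀ := RingHom.ker (coordPresentation X x₀) with hI₀
  set GJ := CechLocalization.gprod G J with hGJ
  set gJ := coordPresentation X x₀ GJ with hgJ
  have hO : cechOpen (basicCover x₀ G) J = X.left.basicOpen gJ := cechOpen_basicCover x₀ G J
  -- the two charts of `U_J = D(g_J)` and the inclusions both ways
  let h₁ : cechScheme X (basicCover x₀ G) J ⟶ Motives.openSubschemeOver X (X.left.basicOpen gJ) :=
    Motives.openSubschemeOverHomOfLE X hO.le
  let h₂ : Motives.openSubschemeOver X (X.left.basicOpen gJ) ⟶ cechScheme X (basicCover x₀ G) J :=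
    Motives.openSubschemeOverHomOfLE X hO.ge
  have h₁₂ : h₁ ≫ h₂ = 𝟙 _ := by
    ext : 1
    rw [Over.comp_left, Motives.openSubschemeOverHomOfLE_left, Motives.openSubschemeOverHomOfLE_left,
      Over.id_left]
    exact (Scheme.homOfLE_homOfLE _ _ _).trans (Scheme.homOfLE_rfl _ _)
  have h₂₁ : h₂ ≫ h₁ = 𝟙 _ := by
    ext : 1
    rw [Over.comp_left, Motives.openSubschemeOverHomOfLE_left, Motives.openSubschemeOverHomOfLE_left,
      Over.id_left]
    exact (Scheme.homOfLE_homOfLE _ _ _).trans (Scheme.homOfLE_rfl _ _)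
  have hx' := coordPresentation_basicOpenCoord_surjective x₀ gJ hx₀
  obtain ⟨F₁, hF₁⟩ := exists_coordLift h₁ (C.surj J) (basicOpenCoord x₀ gJ)
  obtain ⟨F₂, hF₂⟩ := exists_coordLift h₂ hx' (C.coord J)
  have hker : RingHom.ker (coordPresentation _ (basicOpenCoord x₀ gJ)) = BasicOpen.ideal I₀ GJ :=
    ker_coordPresentation_basicOpenCoord x₀ hx₀ rfl
  have hF₁I : (BasicOpen.ideal I₀ GJ).map (bind₁ F₁ : MvPolynomial (Fin (N₀ + 1)) ℂ →ₐ[ℂ]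
      MvPolynomial (Fin (C.N J)) ℂ) ≤ C.ideal J := by
    rw [← hker]
    exact map_le_ker_coordPresentation h₁ hF₁ le_rfl
  have hF₂I : (C.ideal J).map (bind₁ F₂ : MvPolynomial (Fin (C.N J)) ℂ →ₐ[ℂ]
      MvPolynomial (Fin (N₀ + 1)) ℂ) ≤ BasicOpen.ideal I₀ GJ := by
    rw [← hker]
    exact map_le_ker_coordPresentation h₂ hF₂ le_rfl
  -- composites of the inclusions act as the identity on sections
  have happ₁₂ : ∀ s, h₁.left.appTop (h₂.left.appTop s) = s := fun s ↦ by
    rw [← CategoryTheory.comp_apply, ← Scheme.Hom.comp_appTop, ← Over.comp_left, h₁₂, Over.id_left,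
      Scheme.Hom.id_appTop]
    rfl
  have happ₂₁ : ∀ s, h₂.left.appTop (h₁.left.appTop s) = s := fun s ↦ by
    rw [← CategoryTheory.comp_apply, ← Scheme.Hom.comp_appTop, ← Over.comp_left, h₂₁, Over.id_left,
      Scheme.Hom.id_appTop]
    rfl
  have hF₁₂ : ∀ j, MvPolynomial.X j - bind₁ F₁ (F₂ j) ∈ C.ideal J := fun j ↦ by
    rw [ideal, RingHom.mem_ker, map_sub, coordPresentation_X, coordPresentation_bind₁ h₁ hF₁, ← hF₂,
      happ₁₂, sub_self]
  have hF₂₁ : ∀ j, MvPolynomial.X j - bind₁ F₂ (F₁ j) ∈ BasicOpen.ideal I₀ GJ := fun j ↦ by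
    rw [← hker, RingHom.mem_ker, map_sub, coordPresentation_X, coordPresentation_bind₁ h₂ hF₂, ← hF₁,
      happ₂₁, sub_self]
  -- the change of presentation `Ω^q(X_{G_J}) ≃ Ω^q(U_J)` (charts `(x₀, 1/g_J)` and `x_J`)
  obtain ⟨e₀, he₀⟩ : ∃ e₀ : RegularForm (BasicOpen.ideal I₀ GJ) q ≃ₗ[ℂ] RegularForm (C.ideal J) q,
      ∀ y, e₀ y = RegularForm.comap F₁ hF₁I q y :=
    ⟨RegularForm.comapEquiv F₁ F₂ hF₁I hF₂I hF₁₂ hF₂₁ q, fun y ↦ rfl⟩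
  have hιU : h₁ ≫ Motives.openSubschemeOverι X (X.left.basicOpen gJ) =
      Motives.openSubschemeOverι X (cechOpen (basicCover x₀ G) J) :=
    Motives.openSubschemeOverHomOfLE_comp_ι X hO.le
  have hscal : ∀ a : MvPolynomial (Fin N₀) ℂ,
      bind₁ F₁ (rename Fin.castSucc a) - bind₁ (C.lift₀ x₀ J) a ∈ C.ideal J := fun a ↦ by
    rw [ideal, RingHom.mem_ker, map_sub, coordPresentation_bind₁ h₁ hF₁,
      coordPresentation_basicOpenCoord_rename,
      coordPresentation_bind₁ (Motives.openSubschemeOverι X (cechOpen _ J)) (C.lift₀_spec x₀ J),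
      ← CategoryTheory.comp_apply, ← Scheme.Hom.comp_appTop, ← Over.comp_left, hιU, sub_self]
  -- … upgraded to a `ℂ[T]`-linear equivalence `Forms I₀ G_J q ≃ Sec`
  let e : BasicOpen.Forms I₀ GJ q ≃ₗ[MvPolynomial (Fin N₀) ℂ] C.Sec x₀ q p J :=
    { toFun := fun y ↦ C.toSec x₀ q p J (e₀ ((BasicOpen.Forms.of I₀ GJ q).symm y))
      map_add' := fun a b ↦ by simp only [map_add]
      map_smul' := fun a y ↦ by
        obtain ⟨ω, hω⟩ := RegularForm.mk_surjective (BasicOpen.ideal I₀ GJ)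
          ((BasicOpen.Forms.of I₀ GJ q).symm y)
        change C.toSec x₀ q p J (e₀ ((BasicOpen.Forms.of I₀ GJ q).symm (a • y))) =
          a • C.toSec x₀ q p J (e₀ ((BasicOpen.Forms.of I₀ GJ q).symm y))
        rw [Sec.smul_def C x₀ q (p := p) (J := J) a, BasicOpen.Forms.smul_def,
          map_smul (BasicOpen.Forms.of I₀ GJ q).symm, ← hω, ← map_smul (C.toSec x₀ q p J)]
        refine congrArg (C.toSec x₀ q p J) ?_
        rw [he₀, he₀, ← map_smul (RegularForm.mk (BasicOpen.ideal I₀ GJ)), RegularForm.comap_mk,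
          RegularForm.comap_mk, PolyForm.comap_polySmul, map_smul]
        exact C.smul_eq_smul_of_sub_mem_ideal q (hscal a) _
      invFun := fun z ↦ BasicOpen.Forms.of I₀ GJ q (e₀.symm ((C.toSec x₀ q p J).symm z))
      left_inv := fun y ↦ by
        change BasicOpen.Forms.of I₀ GJ q (e₀.symm ((C.toSec x₀ q p J).symm
          (C.toSec x₀ q p J (e₀ ((BasicOpen.Forms.of I₀ GJ q).symm y))))) = y
        rw [LinearEquiv.symm_apply_apply, LinearEquiv.symm_apply_apply, LinearEquiv.apply_symm_apply]
      right_inv := fun z ↦ by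
        change C.toSec x₀ q p J (e₀ ((BasicOpen.Forms.of I₀ GJ q).symm
          (BasicOpen.Forms.of I₀ GJ q (e₀.symm ((C.toSec x₀ q p J).symm z))))) = z
        rw [LinearEquiv.symm_apply_apply, LinearEquiv.apply_symm_apply, LinearEquiv.apply_symm_apply] }
  -- `e ∘ toForms = secι` (both are pull-backs along lifts of `U_J → X`)
  have hcomp : e.toLinearMap ∘ₗ BasicOpen.toForms I₀ GJ q =
      (C.secι x₀ q p J).restrictScalars (MvPolynomial (Fin N₀) ℂ) := by
    refine LinearMap.ext fun r ↦ ?_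
    obtain ⟨ω, rfl⟩ := RegularForm.mk_surjective I₀ r
    change C.toSec x₀ q p J (e₀ ((BasicOpen.Forms.of I₀ GJ q).symm
        (BasicOpen.toForms I₀ GJ q (RegularForm.mk I₀ ω)))) =
      C.toSec x₀ q p J (C.res₀ x₀ J q (RegularForm.mk I₀ ω))
    refine congrArg (C.toSec x₀ q p J) ?_
    rw [BasicOpen.toForms_apply, LinearEquiv.symm_apply_apply, BasicOpen.restrict_mk, he₀,
      RegularForm.comap_mk, PolyForm.comap_comp, res₀, RegularForm.comap_mk, RegularForm.mk_eq_mk_iff]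
    refine PolyForm.comap_sub_comap_mem_vanishingForms (fun j ↦ ?_) ω
    rw [ideal, RingHom.mem_ker, map_sub, BasicOpen.incl_apply, bind₁_X_right, ← hF₁,
      basicOpenCoord_castSucc, ← C.lift₀_spec x₀ J j, ← CategoryTheory.comp_apply,
      ← Scheme.Hom.comp_appTop, ← Over.comp_left, hιU, sub_self]
  haveI : IsLocalizedModule (Submonoid.powers GJ) (BasicOpen.toForms I₀ GJ q) :=
    BasicOpen.isLocalizedModule_toForms
  rw [← hcomp]
  exact IsLocalizedModule.of_linearEquiv (Submonoid.powers GJ) (BasicOpen.toForms I₀ GJ q) e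

include hx₀ in
/-- **`Ω^q(U_J)` is the localization of `Ω^q(X)` at `g_J` over `R = Γ(X, 𝒪) = ℂ[T]/ker φ_{x₀}`**
(`IsLocalizedModule.of_restrictScalars`). [cite: GortzWedhorn2023, Remark 17.19 (4)] -/
theorem isLocalizedModule_secι {p : ℕ} (J : Fin (p + 1) → ι) :
    IsLocalizedModule
      (Submonoid.powers (Ideal.Quotient.mk (RingHom.ker (coordPresentation X x₀))
        (CechLocalization.gprod G J)))
      (C.secι x₀ q p J) := by
  haveI := C.isLocalizedModule_secι_restrictScalars hx₀ q J
  rw [← Ideal.Quotient.algebraMap_eq, ← Algebra.algebraMapSubmonoid_powers]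
  exact IsLocalizedModule.of_restrictScalars (Submonoid.powers (CechLocalization.gprod G J))
    (C.secι x₀ q p J)

include hx₀ in
/-- **The rows of the algebraic Čech–de Rham complex of a basic-open cover of an affine scheme form a
localizing system** (twist `1`) over `R = ℂ[T]/ker φ_{x₀} = Γ(X, 𝒪)`, for `(g_i) = ([G_i])`.
[cite: GortzWedhorn2023, Remark 17.19 (4)] [cite: StacksProject, Tag 01X8] -/
theorem isSystem_sec :
    CechLocalization.IsSystem
      (fun i ↦ Ideal.Quotient.mk (RingHom.ker (coordPresentation X x₀)) (G i)) 1
      (C.Sec x₀ q) (C.secι x₀ q) := by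
  refine ⟨fun p J ↦ ?_⟩
  change IsLocalizedModule (Submonoid.powers (1 * CechLocalization.gprod _ J)) _
  rw [one_mul, show CechLocalization.gprod (fun i ↦ Ideal.Quotient.mk
      (RingHom.ker (coordPresentation X x₀)) (G i)) J =
    Ideal.Quotient.mk _ (CechLocalization.gprod G J) by
      rw [CechLocalization.gprod, CechLocalization.gprod, map_prod]]
  exact C.isLocalizedModule_secι hx₀ q J

/-! ### The Čech differential of the system is `cechδ` -/

variable (hL : CechLocalization.IsSystem
  (fun i ↦ Ideal.Quotient.mk (RingHom.ker (coordPresentation X x₀)) (G i)) 1 (C.Sec x₀ q) (C.secι x₀ q))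

omit [IsAffine X.left] in
/-- `J ∘ δᵢ = J ∘ succAbove i`. [cite: StacksProject, Tag 01X8] -/
theorem faceIdx_eq {p : ℕ} (J : Fin (p + 2) → ι) (i : Fin (p + 2)) :
    CechLocalization.faceIdx J i = J ∘ Fin.succAbove i := by
  funext a
  simp [CechLocalization.faceIdx, SimplexCategory.δ]

omit [IsAffine X.left] in
/-- **The forced restriction maps of the system are the restrictions `res` of the cover data**
(uniqueness of maps out of a localization compatible with `ι`). [cite: StacksProject, Tag 01X8] -/
theorem face_apply_eq_res {p : ℕ} (J : Fin (p + 2) → ι) (i : Fin (p + 2)) (c : C.Forms p q) :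
    CechLocalization.face hL J i (c (CechLocalization.faceIdx J i)) =
      C.toSec x₀ q (p + 1) J (C.res J (Fin.succAbove i) q (c (J ∘ Fin.succAbove i))) := by
  have hu : ∀ y : CechLocalization.pw (fun i ↦ Ideal.Quotient.mk
      (RingHom.ker (coordPresentation X x₀)) (G i)) 1 (J ∘ Fin.succAbove i),
      IsUnit (algebraMap (MvPolynomial (Fin N₀) ℂ ⧸ RingHom.ker (coordPresentation X x₀))
        (Module.End (MvPolynomial (Fin N₀) ℂ ⧸ RingHom.ker (coordPresentation X x₀))
          (C.Sec x₀ q (p + 1) J)) y) := by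
    rw [← faceIdx_eq J i]
    exact CechLocalization.isUnit_face hL J i
  rw [CechLocalization.face, CechLocalization.transfer_apply_congr hL c (faceIdx_eq J i) J _ hu,
    ← CechLocalization.transfer_unique hL (J ∘ Fin.succAbove i) J hu (C.resₗ x₀ q J (Fin.succAbove i))
      (C.resₗ_comp_secι x₀ q J (Fin.succAbove i))]
  rfl

omit [IsAffine X.left] in
/-- **The Čech differential of the localizing system is the Čech differential `cechδ` of the
algebraic Čech–de Rham double complex.** [cite: StacksProject, Tag 01X8] [cite: BottTu1982Forms, §8 (8.4)] -/
theorem cechD_eq_cechδ (p : ℕ) (c : C.Forms p q) :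
    CechLocalization.cechD hL p c = C.cechδ p q c := by
  funext J
  rw [CechLocalization.cechD_apply, cechδ_apply]
  refine Finset.sum_congr rfl fun i _ ↦ ?_
  rw [C.face_apply_eq_res q hL J i c, ← Int.cast_smul_eq_zsmul ℂ, Int.cast_pow, Int.cast_neg,
    Int.cast_one]
  rfl

/-! ### Exact rows and the edge map -/

variable [Finite ι]

omit [IsAffine X.left] in
include hx₀ in
/-- The images `[G_i]` generate the unit ideal of `ℂ[T]/ker φ_{x₀}` when the `g_i = φ_{x₀}(G_i)`
generate the unit ideal of `Γ(X, 𝒪)` (i.e. when the `D(g_i)` cover the affine `X`).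
[cite: Hartshorne1977, II Prop. 2.2 (b)] -/
theorem span_mk_eq_top
    (hcov : Ideal.span (Set.range fun i ↦ coordPresentation X x₀ (G i)) = ⊤) :
    Ideal.span (Set.range fun i ↦
      Ideal.Quotient.mk (RingHom.ker (coordPresentation X x₀)) (G i)) = ⊤ := by
  classical
  haveI := Fintype.ofFinite ι
  obtain ⟨c, hc⟩ := Ideal.mem_span_range_iff_exists_fun.mp
    ((Ideal.eq_top_iff_one _).mp hcov)
  choose a ha using fun i ↦ hx₀ (c i)
  refine (Ideal.eq_top_iff_one _).mpr (Ideal.mem_span_range_iff_exists_fun.mpr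
    ⟨fun i ↦ Ideal.Quotient.mk _ (a i), ?_⟩)
  simp_rw [← map_mul, ← map_sum]
  rw [← map_one (Ideal.Quotient.mk (RingHom.ker (coordPresentation X x₀))), Ideal.Quotient.eq,
    RingHom.mem_ker, map_sub, map_sum, map_one, sub_eq_zero]
  simp_rw [map_mul, ha]
  exact hc

include hx₀ in
/-- **Row exactness** of the algebraic Čech–de Rham complex of a finite basic-open cover of an
affine scheme: `ker δ_{p+1} ⊆ im δ_p` in every row (The Stacks Project Tag 01X9 / Serre vanishing
in Čech form, through `CechLocalization.exists_cechD_eq`). [cite: StacksProject, Tag 01X9]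
[cite: CattaniElZeinGriffithsLe2014, Ch. 2 §2.9.2 (p. 109)] -/
theorem rowExact_of_basicCover
    (hcov : Ideal.span (Set.range fun i ↦ coordPresentation X x₀ (G i)) = ⊤) :
    C.cechDeRham.RowExact := by
  refine ⟨fun p q c hc ↦ ?_⟩
  rw [cechDeRham_δ] at hc
  have hL := C.isSystem_sec hx₀ q
  obtain ⟨b, hb⟩ := CechLocalization.exists_cechD_eq (span_mk_eq_top hx₀ hcov) hL p c
    (by rw [C.cechD_eq_cechδ q hL]; exact hc)
  exact ⟨b, by rw [cechDeRham_δ, ← C.cechD_eq_cechδ q hL p b]; exact hb⟩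

include hx₀ in
/-- **Exactness at the augmentation**: `0 → Ω^q(X) → C⁰(𝔘, Ω^q) → C¹(𝔘, Ω^q)` is exact — a global
regular form is determined by its restrictions to the `U_i`, and compatible local forms glue
(The Stacks Project Tag 00EK, through `CechLocalizationDegreeZero`). [cite: StacksProject, Tag 00EK]
[cite: GortzWedhorn2023, Lemma 22.1] -/
theorem exact_rowAugmentation_of_basicCover
    (hcov : Ideal.span (Set.range fun i ↦ coordPresentation X x₀ (G i)) = ⊤) :
    (C.rowAugmentation x₀).Exact := by
  have hg := span_mk_eq_top hx₀ hcov
  refine ⟨fun n ↦ ?_, fun n c hc ↦ ?_⟩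
  · have hL := C.isSystem_sec hx₀ n
    refine (injective_iff_map_eq_zero _).mpr fun r hr ↦ ?_
    refine CechLocalization.eq_zero_of_forall_ι_eq_zero hg hL fun k ↦ ?_
    change C.toSec x₀ n 0 k (C.res₀ x₀ k n r) = 0
    rw [← restrict_apply, show C.restrict x₀ n r = 0 from hr, Pi.zero_apply, map_zero]
  · have hL := C.isSystem_sec hx₀ n
    rw [cechDeRham_δ] at hc
    obtain ⟨r, hr⟩ := CechLocalization.exists_eq_ι_of_cechD_eq_zero hg hL c
      (by rw [C.cechD_eq_cechδ n hL]; exact hc)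
    refine ⟨r, funext fun k ↦ ?_⟩
    change C.res₀ x₀ k n r = c k
    exact hr k

include hx₀ in
/-- **The edge map `Hⁿ(Ω^•(X), d) → Hⁿ(Tot C^•(𝔘, Ω^•_alg))` is bijective** for a finite basic-open
cover `𝔘 = (D(g_i))` of an affine `X` with onto presentation `φ_{x₀}` (any charts `C` on the
`U_J`): the algebraic de Rham cohomology of the affine `X`, computed on global forms, is the Čech
hypercohomology of `Ω•_alg` on `𝔘` — El Zein–Tu (2.9.1) in the affine case; Grothendieck 1966 (4).
[cite: CattaniElZeinGriffithsLe2014, Ch. 2 §2.9.2 (p. 109)] [cite: Grothendieck1966, p. 96 (4)–(6)] -/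
theorem bijective_edgeMap_of_basicCover
    (hcov : Ideal.span (Set.range fun i ↦ coordPresentation X x₀ (G i)) = ⊤) (n : ℕ) :
    Function.Bijective (C.edgeMap x₀ n) :=
  C.bijective_edgeMap x₀ (C.rowExact_of_basicCover hx₀ hcov)
    (C.exact_rowAugmentation_of_basicCover hx₀ hcov) n

end CoverCharts

end HodgeTheory

end Literature.AlgebraicGeometry.HodgeTheory

end
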